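import Literature.Analysis.FluidPDE.LinearisedNSFourierIteration
import HarnessLib

/-!
# Time regularity of the Fourier-side solution of the linearised Navier–Stokes equation

Analysis/FluidPDE proof file, fifth of the files `LinearisedNSFourier*` (objects in
`LinearisedNSFourierDefs`; the Picard limit in `LinearisedNSFourierIteration`). The vector /
Leray-projected twin of `ScalarFourierTimeRegularity` (and the full-interval twin of
`CorrectorFourierTimeRegularity`) for the linearised Navier–Stokes system along a smooth field
(Constantin–Foias 1988, Ch. 14, (14.3)):

* `PicardHyp.hasDerivWithinAt_picardLim` — **mild ⇒ differential**: on `[0, T]` the Picard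
  limit satisfies `∂ₜ c(l,t,k) = -νₖ c(l,t,k) - (P linSym)(U(t), c(t))(l,k)` as a derivative
  within `[0, T]` (product rule and the fundamental theorem of calculus on
  `c = e^{-νₖt} a + e^{-νₖt}∫₀ᵗ e^{νₖs}(-P linSym)(s) ds`; Lemarié-Rieusset 2016, §8.5);
* `IsCoeffFamily.linFamily`, `IsCoeffFamily.projFamily`, `IsCoeffFamily.bootRHS'` — closure
  of coefficient families (`ScalarFourier.IsCoeffFamily`) under the linearised and projected
  families and the bootstrap right-hand side (Leibniz families of the lattice convolutions,
  `ScalarFourier.IsCoeffFamily.transportFamily`; the Leray entries and `-νₖ` are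
  time-independent symbols of polynomial growth);
* `PicardHyp.exists_coeffFamily` — **families of all orders**: if the drift coefficients are,
  on `[0, T]`, the zeroth members of families of every order (the coefficients of `∂ₜⁱuⱼ`), then
  every component `c l` of the Picard limit starts a coefficient family of every order `n`
  (`∂ₜWᵢ = Wᵢ₊₁` within `[0, T]`, every decay, continuity), by the bootstrap
  `Wᵢ₊₁ := -νₖ Wᵢ - (P linSym)ᵢ`.

## References

* P. Constantin, C. Foias, *Navier–Stokes Equations*, Univ. Chicago Press 1988, Ch. 14, (14.3). [`ConstantinFoiasNSE1988`]
* P. G. Lemarié-Rieusset, *The Navier–Stokes problem in the 21st century*, CRC 2016, §8.5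
  (equivalence of mild and differential formulations).
-/

noncomputable section

open MeasureTheory Real Set Filter Topology UnitAddTorus

namespace Literature.Analysis.FluidPDE

namespace LinearisedNSFourier

open ScalarFourier
open CorrectorFourier (leraySym norm_leraySym_le)
open FourierNS (HasDecay clamp)
open Literature.Analysis.FunctionSpaces.Torus (freqNormSq)

variable {d : Type*} [Fintype d] [DecidableEq d]
variable {ν T : ℝ} {U : d → ℝ → (d → ℤ) → ℂ} {a : d → (d → ℤ) → ℂ}

/-! ### Mild ⇒ differential -/

/-- **Mild ⇒ differential.** The Picard limit `c` satisfies, at every component `l`, frequency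
`k` and `t ∈ [0, T]`, `∂ₜ c(l,t,k) = -νₖ c(l,t,k) - (P linSym)(U(t), c(t))(l,k)` as a derivative
within `[0, T]` (differentiate `c(t) = e^{-νₖt} a + e^{-νₖt} ∫₀ᵗ e^{νₖs} (-P linSym)(s) ds` by
the product rule and the fundamental theorem of calculus; equivalence of mild and differential
formulations, Lemarié-Rieusset 2016, §8.5). [folklore] -/
theorem PicardHyp.hasDerivWithinAt_picardLim (h : PicardHyp ν T U a) (l : d) (k : d → ℤ) {t : ℝ}
    (ht : t ∈ Icc 0 T) :
    HasDerivWithinAt (fun s => picardLim ν T U a l s k)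
      (-(heatRate ν k : ℂ) * picardLim ν T U a l t k -
        linProjSym (fun j => U j t) (fun j => picardLim ν T U a j t) l k) (Icc 0 T) t := by
  set c := picardLim ν T U a with hc
  set r := heatRate ν k with hr
  obtain ⟨R, -, hcd⟩ := h.hasDecay_picardLim (latOrder d + 1)
  have hcc : ∀ l m, Continuous fun t => c l t m := h.continuous_picardLim
  set P : ℝ → ℂ := fun s => -linProjSym (fun j => U j s) (fun j => c j s) l k with hP
  have hPc : Continuous P := (h.continuous_linProjSym hcc hcd l k).neg
  -- `G s = ∫₀ˢ e^{rσ} P(σ) dσ` and its derivative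
  set G : ℝ → ℂ := fun s => ∫ σ in (0 : ℝ)..s, Real.exp (r * σ) • P σ with hG
  have hGi : Continuous fun σ => Real.exp (r * σ) • P σ := by fun_prop
  have hG' : ∀ s, HasDerivAt G (Real.exp (r * s) • P s) s := fun s =>
    (hGi.integral_hasStrictDerivAt 0 s).hasDerivAt
  -- the heat factor and its derivative
  have hE' : ∀ s, HasDerivAt (fun s => Real.exp (-(r * s))) (-r * Real.exp (-(r * s))) s := by
    intro s
    have := ((hasDerivAt_id s).const_mul r).neg.exp
    simpa [mul_comm] using this
  -- `F s = e^{-rs} a + e^{-rs} G s` is the Duhamel formula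
  set F : ℝ → ℂ := fun s => Real.exp (-(r * s)) • a l k + Real.exp (-(r * s)) • G s with hF
  have hF' : ∀ s, HasDerivAt F (-(r : ℂ) * F s + P s) s := by
    intro s
    have h1 : HasDerivAt (fun s => Real.exp (-(r * s)) • a l k) ((-r * Real.exp (-(r * s))) • a l k) s :=
      (hE' s).smul_const _
    have h2 : HasDerivAt (fun s => Real.exp (-(r * s)) • G s)
        (Real.exp (-(r * s)) • (Real.exp (r * s) • P s) + (-r * Real.exp (-(r * s))) • G s) s :=
      (hE' s).smul (hG' s)
    have h3 := h1.add h2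
    have hone : Real.exp (-(r * s)) * Real.exp (r * s) = 1 := by
      rw [← Real.exp_add]; simp
    have hone' : (Real.exp (-(r * s)) : ℂ) * (Real.exp (r * s) : ℂ) = 1 := by
      rw [← Complex.ofReal_mul, hone, Complex.ofReal_one]
    have heq : (-r * Real.exp (-(r * s))) • a l k +
        (Real.exp (-(r * s)) • (Real.exp (r * s) • P s) + (-r * Real.exp (-(r * s))) • G s) =
        -(r : ℂ) * F s + P s := by
      simp only [hF, Complex.real_smul, Complex.ofReal_mul, Complex.ofReal_neg]
      linear_combination (P s) * hone'
    rw [heq] at h3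
    exact h3
  -- on `[0, T]`, `c l s k = F s`
  have hcF : ∀ s ∈ Icc 0 T, c l s k = F s := by
    intro s hs
    have hfix := h.picardLim_eq_picardMap l s k
    rw [← hc] at hfix
    rw [hfix]
    simp only [picardMap, FourierNS.clamp_of_mem hs, heatFactor_apply, hF, Complex.real_smul]
    rw [sub_eq_add_neg]
    congr 1
    rw [hG, ← intervalIntegral.integral_const_mul, ← intervalIntegral.integral_neg]
    refine intervalIntegral.integral_congr fun σ _ => ?_
    have hexp : (Real.exp (-(heatRate ν k * (s - σ))) : ℂ) =
        (Real.exp (-(heatRate ν k * s)) : ℂ) * (Real.exp (heatRate ν k * σ) : ℂ) := by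
      rw [← Complex.ofReal_mul, ← Real.exp_add]
      congr 2
      ring
    simp only [Complex.real_smul, ← mul_assoc, hP, mul_neg, hr]
    rw [hexp]
  have key := (hF' t).hasDerivWithinAt (s := Icc 0 T)
  rw [← hcF t ht] at key
  have key2 := key.congr (fun s hs => hcF s hs) (hcF t ht)
  have hval : -(r : ℂ) * c l t k - linProjSym (fun j => U j t) (fun j => c j t) l k =
      -(r : ℂ) * c l t k + P t := by
    simp only [hP]; ring
  rw [hval]
  exact key2

/-! ### Families: closure under the projected linearised symbol -/

section Family

variable {n : ℕ}

omit [DecidableEq d] in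
/-- **The linearised family of families is a family** (two transport families). [folklore] -/
theorem IsCoeffFamily.linFamily (hT : 0 < T) {UF CF : d → ℕ → ℝ → (d → ℤ) → ℂ}
    (hUF : ∀ j, IsCoeffFamily T n (UF j)) (hCF : ∀ j, IsCoeffFamily T n (CF j)) (l : d) :
    IsCoeffFamily T n (linFamily UF CF l) :=
  (IsCoeffFamily.transportFamily hT hUF (hCF l)).add (IsCoeffFamily.transportFamily hT hCF (hUF l))

/-- **The projected family of families is a family** (the Leray entries are time-independent
symbols bounded by `2`). [folklore] -/
theorem IsCoeffFamily.projFamily (hT : 0 < T) {UF CF : d → ℕ → ℝ → (d → ℤ) → ℂ}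
    (hUF : ∀ j, IsCoeffFamily T n (UF j)) (hCF : ∀ j, IsCoeffFamily T n (CF j)) (l : d) :
    IsCoeffFamily T n (projFamily UF CF l) :=
  IsCoeffFamily.finset_sum _ fun m _ =>
    (IsCoeffFamily.linFamily hT hUF hCF m).symbol (σ := fun k => leraySym l m k) (g := 0)
      zero_le_two fun k => by simpa using norm_leraySym_le l m k

/-- **The bootstrap right-hand side of families is a family**: `-νₖ CFₗ - (P linSym)ₗ`
(`ν ≥ 0`). [folklore] -/
theorem IsCoeffFamily.bootRHS' (hT : 0 < T) (hν : 0 ≤ ν) {UF CF : d → ℕ → ℝ → (d → ℤ) → ℂ}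
    (hUF : ∀ j, IsCoeffFamily T n (UF j)) (hCF : ∀ j, IsCoeffFamily T n (CF j)) (l : d) :
    IsCoeffFamily T n (bootRHS ν UF CF l) :=
  ((hCF l).symbol (σ := fun k => -(heatRate ν k : ℂ)) (g := 2) (by positivity)
    (norm_heatRate_le hν)).sub (IsCoeffFamily.projFamily hT hUF hCF l)

end Family

/-! ### Families of all orders for the Picard limit -/

/-- **Families of all orders for the Picard limit.** Let the drift coefficients `U` be, on
`[0, T]`, the zeroth members of coefficient families `UF ⱼ` of every order (in the application:
the coefficients of `∂ₜⁱuⱼ`). Then for every `n` the components of the Picard limit are the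
zeroth members of coefficient families of order `n` on `[0, T]` (`∂ₜ Wᵢ = Wᵢ₊₁` within
`[0, T]`, every decay, continuity): induction on `n` via `∂ₜ cₗ = -νₖ cₗ - (P linSym)ₗ` and
the closure `IsCoeffFamily.bootRHS'`, as `ScalarFourier.PicardHyp.exists_coeffFamily`. [folklore] -/
theorem PicardHyp.exists_coeffFamily (h : PicardHyp ν T U a) {UF : d → ℕ → ℝ → (d → ℤ) → ℂ}
    (hUF : ∀ n j, IsCoeffFamily T n (UF j)) (hU0 : ∀ j, ∀ t ∈ Icc 0 T, UF j 0 t = U j t) (n : ℕ) :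
    ∃ W : d → ℕ → ℝ → (d → ℤ) → ℂ, (∀ l, W l 0 = picardLim ν T U a l) ∧
      ∀ l, IsCoeffFamily T n (W l) := by
  set c := picardLim ν T U a with hc
  have base : ∀ l, IsCoeffFamily T 0 (fun _ => c l) := fun l =>
    { decay := fun i _ K => by
        obtain ⟨C, -, hC⟩ := h.hasDecay_picardLim K
        exact ⟨C, fun t _ => hC l t⟩
      cont := fun i _ m => (h.continuous_picardLim l m).continuousOn
      deriv := fun i hi => absurd hi (Nat.not_lt_zero i) }
  induction n with
  | zero => exact ⟨fun l _ => c l, fun l => rfl, base⟩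
  | succ n ih =>
    obtain ⟨W, hW0, hW⟩ := ih
    set D : d → ℕ → ℝ → (d → ℤ) → ℂ := fun l => bootRHS ν UF W l with hD
    have hDf : ∀ l, IsCoeffFamily T n (D l) := fun l =>
      IsCoeffFamily.bootRHS' h.hT h.hν.le (fun j => hUF n j) hW l
    refine ⟨fun l => consFamily (c l) (D l), fun l => rfl, fun l => ?_⟩
    refine ⟨fun i hi K => ?_, fun i hi m => ?_, fun i hi m t ht => ?_⟩
    · cases i with
      | zero => exact (base l).decay 0 le_rfl K
      | succ i => exact (hDf l).decay i (by omega) K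
    · cases i with
      | zero => exact (base l).cont 0 le_rfl m
      | succ i => exact (hDf l).cont i (by omega) m
    · cases i with
      | zero =>
        have hd := h.hasDerivWithinAt_picardLim l m ht
        simp only [consFamily_zero, consFamily_succ, zero_add]
        convert hd using 1
        simp only [hD, bootRHS_apply, projFamily_zero, hW0, ← hc]
        have hU' : (fun j => UF j 0 t) = fun j => U j t := funext fun j => hU0 j t ht
        rw [hU']
      | succ i =>
        simp only [consFamily_succ]
        exact (hDf l).deriv i (by omega) m t ht

end LinearisedNSFourier

end Literature.Analysis.FluidPDE

end
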